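import Summits.BirchSwinnertonDyer.Rank1Residual.X11b.KummerLocalTorsionSaturation
import Summits.BirchSwinnertonDyer.Rank1Residual.X11b.PropagatedUnramified
import Summits.BirchSwinnertonDyer.Rank1Residual.X11b.BDPRouteRelaxation
import Summits.BirchSwinnertonDyer.Rank1Residual.X11b.WeilTransport
import Summits.BirchSwinnertonDyer.Rank1Residual.X11b.LevelLiftingLower
import Literature.NumberTheory.GaloisCohomology.PoitouTateSelmerStructures
import HarnessLib

/-!
# X11b, routes p2/R1 — the KUMMER Selmer structure of `E[n]` is UNRAMIFIED OUTSIDE `∞ ∪ {v ∣ p} ∪ bad`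
# and SELF-DUAL under the Weil transport: `H¹_{𝓚^*}(K, E[n]^D) = w_* Sel^{(n)}(E/K)`
# (cell `b2b-bsdres`, sub-cell `multr1-p2`, gen 19)

HONEST FRAMING (cell `b2b-bsdres`, run/shared/lean/b2b/bsd-rank1-residual/, verbatim in every
file): the goal of the cell is to DELETE the COMBINATION-SHAPED residual classes of the
Birch–Swinnerton-Dyer formula for ALL analytic-rank `≤ 1` elliptic curves over `ℚ` — "full BSD
formula for every rank `≤ 1` curve in class `C`" assembled STRICTLY from published theorems — so
that the rank-`≤ 1` remainder becomes exactly the CONSTRUCTION-SHAPED classes, which are TYPED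
(missing-input `Prop`s), NOT attempted. This is not "finishing BSD". Sub-cell
`b2b-bsdres-multr1-p2` (X11b, route p2); a RESEARCH ROUTE; no claim beyond the stated class; X11b
stays CONSTRUCTION-SHAPED; nothing here changes a label; no named fact is minted (theorems only; no
`sorry`).

## What is here (step 3 towards the EXACT base Selmer count, JSW17 Prop. 3.2.1 `=`)

To apply the tree's Poitou–Tate fact for Selmer structures (`poitouTate_selmerStructure_duality`:
Howard Thm. 2.1.11, `SelmerComplement`) to the KUMMER Selmer structure `𝓚 = kummerSelmerStructure W n`
on `E[n]` (whose Selmer group is `Sel^{(n)}(E/K)`), two inputs are needed and proved here: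

* `kummerSelmerStructure_isUnramifiedOutside` — for `n = p^k`, `𝓚` is a Selmer structure
  **unramified outside** every finite `T ⊇ ∞ ∪ {v ∣ p} ∪ {bad}` (Howard Def. 2.1.10): at a good
  `v ∤ p` the local Kummer condition is the propagated zero condition (gen 19,
  `kummerLocalConditionAt_eq_ker_map_primaryInclusion`) which is the unramified subgroup
  (multr1-p1, `ker_map_primaryInclusion_restrictField_eq_unramifiedSubgroup`).
* **Self-duality under the Weil transport.** With a Weil pairing `e` on `E[n]` and a Poitou–Tate
  family `inv`: `annRight_invWeilPairing_kummerSelmerStructure_eq` — at every place the local Kummer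
  condition is its own RIGHT annihilator under `inv_v(· ∪ₑ ·)` (isotropy, Poonen–Rains; right-kernel
  triviality `eq_zero_of_forall_weilCupProduct_eq_zero_right_inr` + Tate's local Euler characteristic
  at the finite places; vanishing of `H¹` at the complex places); hence
  `map_weilDualInv_mem_kummerSelmerStructure_of_mem_dual` (`𝓚_v^* ⊆ w_v(𝓚_v)`) and
  **`map_weilDualInv_mem_selmerGroup_of_mem_dualSelmerGroup`**: every class of the DUAL Selmer group
  `H¹_{𝓚^*}(K, E[n]^D)` is the Weil transport `H¹(w)(s)` of an `n`-Selmer class `s` ("`T^* = T`,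
  `𝓕^* = 𝓕`" of JSW17 Prop. 3.2.1 / Milne I Cor. 3.4, at finite level).
* `selmerGroup_update_top_eq_kummerOutside`, `kummerSelmerStructure_le_update_top`,
  `update_top_isUnramifiedOutside` — the structure `𝓚` RELAXED at one place `v₀` (no condition there)
  has Selmer group `kummerOutside W n {v₀}`, the object of route p2's Part B.

References: [Howard2004HeegnerKolyvagin] Def. 2.1.6, 2.1.10, Thm. 2.1.11; [MilneADT2006] I Thm. 2.6,
Cor. 3.4, Thm. 2.8, Lemma 6.15; [PoonenRains2012] Prop. 4.10; [JetchevSkinnerWan2017] Prop. 3.2.1.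
-/

noncomputable section

open scoped Classical

universe u

open CategoryTheory Field Function NumberField IsDedekindDomain WeierstrassCurve
open Literature.NumberTheory.EllipticCurves Literature.NumberTheory.EllipticCurves.GreenbergSelmer
open Literature.NumberTheory.GaloisRepresentations
open Literature.NumberTheory.GaloisRepresentations.DiscreteGaloisModule (mu MuCarrier SelmerStructure
  localTatePairingZMod tateDual unramifiedSubgroup)
open Literature.NumberTheory.GaloisCohomology
open Summit.BirchSwinnertonDyer.Rank1Residual.X11b.FiniteDuality
open Summit.BirchSwinnertonDyer.Rank1Residual.X11b.Relaxation
open Summit.BirchSwinnertonDyer.Rank1Residual.X11b.LocBridge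
open Summit.BirchSwinnertonDyer.Rank1Residual.X11b.Levels
open scoped ContRepresentation

namespace Summit.BirchSwinnertonDyer.Rank1Residual.X11b.KummerDuality

-- Cup products need `LocallyCompactSpace Γ`; as in the tree's cup-product files, the compactness of
-- absolute Galois groups is a local instance only.
attribute [local instance] absoluteGaloisGroup_compactSpace
attribute [local instance] finite_geomTorsion_of_neZero Literature.NumberTheory.EllipticCurves.finite_muCarrier

/-! ## §1. `𝓚` is unramified outside `∞ ∪ {v ∣ p} ∪ {bad}`; the structure relaxed at one place -/

section Unramified

variable {K : Type} [Field K] [NumberField K] (W : WeierstrassCurve K) [W.IsElliptic] (p k : ℕ)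
  [Fact p.Prime]

/-- **The Kummer Selmer structure on `E[p^k]` is unramified outside every finite
`T ⊇ ∞ ∪ {v ∣ p} ∪ {bad}`** (Howard Def. 2.1.10): at a good finite `v ∤ p` outside `T` the local Kummer
condition `𝓛_v = im(E(K_v)/p^k ↪ H¹(K_v, E[p^k]))` IS the unramified subgroup `H¹_ur(K_v, E[p^k])`
(Gross's (7.1); here: Kummer = propagated zero condition (gen 19) = unramified (multr1-p1)).
[cite: Howard2004HeegnerKolyvagin, Def. 2.1.10 (arXiv:1202.6340 p. 6)] [cite: Gross1991, (7.1)]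
[cite: MilneADT2006, Ch. I §6, (6.5)] -/
theorem kummerSelmerStructure_isUnramifiedOutside (T : Finset (Place K))
    (hinf : ∀ w : InfinitePlace K, (Sum.inl w : Place K) ∈ T)
    (hp : ∀ v : HeightOneSpectrum (𝓞 K), ((p : ℕ) : 𝓞 K) ∈ v.asIdeal → (Sum.inr v : Place K) ∈ T)
    (hbad : ∀ v : HeightOneSpectrum (𝓞 K), ¬ W.HasGoodReductionAt v → (Sum.inr v : Place K) ∈ T) :
    SelmerStructure.IsUnramifiedOutside (W.kummerSelmerStructure ((p ^ k : ℕ) : ℤ)) T := by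
  refine ⟨hinf, fun v hv ↦ ?_⟩
  have hpv : ((p : ℕ) : 𝓞 K) ∉ v.asIdeal := fun h ↦ hv (hp v h)
  have hgood : W.HasGoodReductionAt v := by
    by_contra h
    exact hv (hbad v h)
  have hn : ((p ^ k : ℕ) : ℤ) ≠ 0 := by exact_mod_cast pow_ne_zero k (Fact.out : p.Prime).ne_zero
  rw [WeierstrassCurve.kummerSelmerStructure_apply]
  change W.kummerLocalConditionAt ((p ^ k : ℕ) : ℤ) (v.adicCompletion K) = _
  rw [LevelKummer.kummerLocalConditionAt_eq_ker_map_primaryInclusion W p k v hpv hn]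
  exact AcSelmer.ker_map_primaryInclusion_restrictField_eq_unramifiedSubgroup W p k hpv hgood

end Unramified

section Update

variable {K : Type} [Field K] [NumberField K] (W : WeierstrassCurve K) (n : ℕ) (v₀ : Place K)

/-- **The Kummer structure relaxed at one place has Selmer group `kummerOutside W n {v₀}`**
(`H¹_{𝓛, ⊤ at v₀}(K, E[n])`: Kummer condition at every place except `v₀`, none at `v₀`).
[cite: MilneADT2006, Ch. I §6, Lemma 6.15] -/
theorem selmerGroup_update_top_eq_kummerOutside :
    SelmerStructure.selmerGroup
        (Function.update (W.kummerSelmerStructure (n : ℤ)) v₀ ⊤ :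
          SelmerStructure (W.torsionGaloisModule (n : ℤ))) = kummerOutside W n {v₀} := by
  ext c
  rw [SelmerStructure.mem_selmerGroup_iff, mem_kummerOutside_iff]
  constructor
  · intro h v hv
    rw [Finset.mem_singleton] at hv
    have h' := h v
    rw [Function.update_of_ne hv] at h'
    exact h'
  · intro h v
    by_cases hv : v = v₀
    · subst hv
      rw [Function.update_self]
      exact AddSubgroup.mem_top _
    · rw [Function.update_of_ne hv]
      exact h v (by rwa [Finset.mem_singleton])

/-- `𝓚 ≤ 𝓚[⊤ at v₀]`. [folklore] -/
theorem kummerSelmerStructure_le_update_top :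
    W.kummerSelmerStructure (n : ℤ) ≤ Function.update (W.kummerSelmerStructure (n : ℤ)) v₀ ⊤ := by
  intro v
  by_cases hv : v = v₀
  · subst hv
    rw [Function.update_self]
    exact le_top
  · rw [Function.update_of_ne hv]

/-- If `𝓚` is unramified outside `T ∋ v₀`, so is `𝓚[⊤ at v₀]`.
[cite: Howard2004HeegnerKolyvagin, Def. 2.1.10 (arXiv:1202.6340 p. 6)] -/
theorem update_top_isUnramifiedOutside {T : Finset (Place K)} (hv₀ : v₀ ∈ T)
    (h : SelmerStructure.IsUnramifiedOutside (W.kummerSelmerStructure (n : ℤ)) T) :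
    SelmerStructure.IsUnramifiedOutside (Function.update (W.kummerSelmerStructure (n : ℤ)) v₀ ⊤) T := by
  refine ⟨h.1, fun v hv ↦ ?_⟩
  have hne : (Sum.inr v : Place K) ≠ v₀ := fun heq ↦ hv (heq ▸ hv₀)
  rw [Function.update_of_ne hne]
  exact h.2 v hv

end Update

/-! ## §2. The local Kummer condition is its own RIGHT annihilator under `inv_v(· ∪ₑ ·)` -/

section SelfDual

variable {K : Type} [Field K] [NumberField K] (W : WeierstrassCurve K) [W.IsElliptic]
variable (n : ℕ) [NeZero n]
variable (e : geomTorsion W n → geomTorsion W n → AlgebraicClosure K)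
  (hμ : ∀ S T, e S T ^ n = 1)
  (hadd₁ : ∀ S₁ S₂ T, e (S₁ + S₂) T = e S₁ T * e S₂ T)
  (hadd₂ : ∀ S T₁ T₂, e S (T₁ + T₂) = e S T₁ * e S T₂)
  (hgal : ∀ (σ : absoluteGaloisGroup K) (S T : geomTorsion W n), σ • e S T = e (σ • S) (σ • T))
  (halt : ∀ T, e T T = 1) (hnondeg : ∀ T, (∀ S, e S T = 1) → T = 0)
  (inv : LocalInvariants K n)

include halt hnondeg in
/-- **At a finite place `v`, `𝓛_v` is its own right annihilator under `inv_v(· ∪ₑ ·)`** — given the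
injectivity of `inv_v` (a Poitou–Tate family is perfect) and Tate's local Euler-characteristic count
`#H¹(K_v, E[n]) = (#E(K_v)[n] · #𝒪_v/n)² = #𝓛_v²`: isotropy gives `𝓛_v ≤ 𝓛_v^⊥`, the right kernel of
the pairing is trivial (local Tate duality for `E[n]`, Milne I Cor. 2.3), and `#𝓛_v^⊥ · #𝓛_v = #H¹`.
(Tate local duality for `E`, Milne I Cor. 3.4, at finite level, right-handed.)
[cite: MilneADT2006, Ch. I, Cor. 2.3, Thm. 2.8, Cor. 3.4 and Lemma 6.15] [cite: PoonenRains2012, Prop. 4.10] -/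
theorem annRight_invWeilPairing_kummerSelmerStructure_inr (v : HeightOneSpectrum (𝓞 K))
    (hinv : Injective (inv (Sum.inr v)))
    (hEuler : Nat.card (galoisCohomology ((W.torsionGaloisModule n).toLocal (Sum.inr v)) 1) =
      (Nat.card (nsmulAddMonoidHom n : (W.baseChange (v.adicCompletion K)).toAffine.Point →+ _).ker *
        Nat.card (v.adicCompletionIntegers K ⧸ Ideal.span {(n : v.adicCompletionIntegers K)})) ^ 2) :
    annRight (invWeilPairing W n e hμ hadd₁ hadd₂ hgal inv (Sum.inr v))
        (W.kummerSelmerStructure n (Sum.inr v)) = W.kummerSelmerStructure n (Sum.inr v) := by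
  haveI : CharZero (v.adicCompletion K) := charZero_adicCompletion v
  set b := invWeilPairing W n e hμ hadd₁ hadd₂ hgal inv (Sum.inr v) with hb
  set L := W.kummerSelmerStructure n (Sum.inr v) with hL
  haveI hfinA : Finite (galoisCohomology ((W.torsionGaloisModule n).toLocal (Sum.inr v)) 1) := by
    change Finite (galoisCohomology (GaloisRep.restrictField (v.adicCompletion K) (W.torsionGaloisModule n)) 1)
    exact finite_galoisCohomology_one_of_isNonarchimedeanLocalField _
  have hA : ∀ x : galoisCohomology ((W.torsionGaloisModule n).toLocal (Sum.inr v)) 1, n • x = 0 :=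
    nsmul_continuousCohomology_one_eq_zero _ n (fun T : geomTorsion W n => AddSubgroup.torsionBy.nsmul T)
  haveI := finite_addMonoidHom_zmod (galoisCohomology ((W.torsionGaloisModule n).toLocal (Sum.inr v)) 1) n
  -- isotropy: `L ≤ L^⊥`
  have hle : L ≤ annRight b L := fun y hy x hx ↦
    invWeilPairing_eq_zero_of_mem W n e hμ hadd₁ hadd₂ hgal halt inv (Sum.inr v) hx hy
  -- the right adjoint is bijective
  have hflip : Bijective b.flip := by
    have hinj : Injective b.flip := by
      intro y y' h
      rw [← sub_eq_zero]
      refine eq_zero_of_forall_weilCupProduct_eq_zero_right_inr W n e hμ hadd₁ hadd₂ v hgal hnondeg _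
        fun x => ?_
      have h1 : b x (y - y') = 0 := by
        rw [map_sub, sub_eq_zero]
        exact DFunLike.congr_fun h x
      rw [hb, invWeilPairing_apply] at h1
      exact hinv (h1.trans (map_zero _).symm)
    exact hinj.bijective_of_nat_card_le (Nat.card_addMonoidHom_zmod hA).le
  -- counting
  have hNL : Nat.card (annRight b L) * Nat.card L =
      Nat.card (galoisCohomology ((W.torsionGaloisModule n).toLocal (Sum.inr v)) 1) :=
    natCard_annRight_mul hA b hflip L
  have hLcard : Nat.card L = Nat.card (nsmulAddMonoidHom n :
        (W.baseChange (v.adicCompletion K)).toAffine.Point →+ _).ker *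
      Nat.card (v.adicCompletionIntegers K ⧸ Ideal.span {(n : v.adicCompletionIntegers K)}) :=
    W.natCard_kummerSelmerStructure_inr v (NeZero.ne n)
  have hLpos : 0 < Nat.card L := Nat.card_pos
  have hcard : Nat.card (annRight b L) = Nat.card L := by
    have h2 : Nat.card (annRight b L) * Nat.card L = Nat.card L * Nat.card L := by
      rw [hNL, hEuler, hLcard, sq]
    exact Nat.eq_of_mul_eq_mul_right hLpos h2
  exact (AddSubgroup.eq_of_le_of_card_ge hle hcard.le).symm

omit [W.IsElliptic] in
/-- **At a complex place every local condition is its own annihilator** (`H¹(K_w, E[n]) = 0`).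
[cite: GreenbergLNM1716, §3 p. 87] -/
theorem annRight_invWeilPairing_kummerSelmerStructure_inl {w : InfinitePlace K} (hw : w.IsComplex) :
    annRight (invWeilPairing W n e hμ hadd₁ hadd₂ hgal inv (Sum.inl w))
        (W.kummerSelmerStructure n (Sum.inl w)) = W.kummerSelmerStructure n (Sum.inl w) := by
  rw [LocBridge.eq_top_of_isComplex (W.torsionGaloisModule n) hw (W.kummerSelmerStructure n (Sum.inl w)),
    LocBridge.eq_top_of_isComplex (W.torsionGaloisModule n) hw (annRight _ ⊤)]

include halt hnondeg in
/-- **Self-annihilation at every place**, for `K` with all infinite places complex, a perfect family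
`inv` (`IsPerfect`) and Tate's local Euler characteristic at every finite place (named fact
`localEulerPoincareCharacteristic`, Milne I Thm. 2.8), `n` a prime power.
[cite: MilneADT2006, Ch. I, Cor. 3.4, Thm. 2.8 and Lemma 6.15] -/
theorem annRight_invWeilPairing_kummerSelmerStructure_eq (hK : ∀ w : InfinitePlace K, w.IsComplex)
    (hn : IsPrimePow n) (hperf : inv.IsPerfect)
    (hEP : ∀ v : HeightOneSpectrum (𝓞 K), localEulerPoincareCharacteristic (v.adicCompletion K))
    (v : Place K) :
    annRight (invWeilPairing W n e hμ hadd₁ hadd₂ hgal inv v) (W.kummerSelmerStructure n v) =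
      W.kummerSelmerStructure n v := by
  rcases v with w | v
  · exact annRight_invWeilPairing_kummerSelmerStructure_inl W n e hμ hadd₁ hadd₂ hgal inv (hK w)
  · exact annRight_invWeilPairing_kummerSelmerStructure_inr W n e hμ hadd₁ hadd₂ hgal halt hnondeg inv v
      (hperf v).1.1 (natCard_galoisCohomology_one_torsion_adicCompletion_eq_sq W v n hn (hEP v))

/-! ## §3. The dual Selmer structure of `𝓚` is the Weil transport of `𝓚` -/

/-- **`𝓚_v^* ⊆ w_v(𝓚_v)`**: if `b' ∈ H¹(K_v, E[n]^D)` annihilates the local Kummer condition under the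
local Tate pairing, then its inverse Weil transport `H¹(w_v⁻¹) b'` satisfies the local Kummer
condition — because `⟨a, H¹(w_v) y⟩_v = inv_v(a ∪ₑ y)` (`localTatePairingZMod_map_weilDual`) and
`𝓛_v` is its own right annihilator under `inv_v(· ∪ₑ ·)`.
[cite: Howard2004HeegnerKolyvagin, Def. 2.1.6 (arXiv:1202.6340 p. 5)] [cite: MilneADT2006, Ch. I, Cor. 3.4] -/
theorem map_weilDualInv_mem_kummerSelmerStructure_of_mem_dual (v : Place K)
    (hmax : annRight (invWeilPairing W n e hμ hadd₁ hadd₂ hgal inv v) (W.kummerSelmerStructure n v) =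
      W.kummerSelmerStructure n v)
    {b' : galoisCohomology (((W.torsionGaloisModule n).tateDual n).toLocal v) 1}
    (hb' : b' ∈ inv.dualSelmerStructure (W.torsionGaloisModule n) (W.kummerSelmerStructure n) v) :
    galoisCohomology.map ((weilDualInv W n e hμ hadd₁ hadd₂ hgal hnondeg).restrictField
        (Place.Completion v)) 1 b' ∈ W.kummerSelmerStructure n v := by
  set y := galoisCohomology.map ((weilDualInv W n e hμ hadd₁ hadd₂ hgal hnondeg).restrictField
    (Place.Completion v)) 1 b' with hy
  rw [← hmax]
  refine (mem_annRight_iff _ _ _).mpr fun a ha ↦ ?_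
  rw [LocalInvariants.dualSelmerStructure_apply, LocalInvariants.mem_dualLocalCondition_iff] at hb'
  have key : localTatePairingZMod (W.torsionGaloisModule n) n v (inv v) a
      (galoisCohomology.map ((weilDualIntertwining W n e hμ hadd₁ hadd₂ hgal).restrictField
        (Place.Completion v)) 1 y) = 0 := by
    rw [hy, map_weilDual_map_weilDualInv_restrictField]
    exact hb' a ha
  rw [localTatePairingZMod_map_weilDual] at key
  exact key

/-- **Every class of the dual Selmer group `H¹_{𝓚^*}(K, E[n]^D)` is the Weil transport of an
`n`-Selmer class**: `H¹(w⁻¹) y ∈ Sel^{(n)}(E/K)` (so `H¹_{𝓚^*}(K, E[n]^D) = H¹(w)(Sel^{(n)}(E/K))`) —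
the finite-level form of "`𝓕_ac^* = 𝓕_ac` under `T^* = T`" in JSW17's proof of Prop. 3.2.1 /
Milne I Lemma 6.15, given self-annihilation of the local Kummer conditions at every place.
[cite: JetchevSkinnerWan2017, Prop. 3.2.1 (proof, arXiv:1512.06894 p. 10)]
[cite: Howard2004HeegnerKolyvagin, Def. 2.1.10 and Thm. 2.1.11 (arXiv:1202.6340 p. 6)] -/
theorem map_weilDualInv_mem_selmerGroup_of_mem_dualSelmerGroup
    (hmax : ∀ v : Place K, annRight (invWeilPairing W n e hμ hadd₁ hadd₂ hgal inv v)
      (W.kummerSelmerStructure n v) = W.kummerSelmerStructure n v)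
    {y : galoisCohomology ((W.torsionGaloisModule n).tateDual n) 1}
    (hy : y ∈ (inv.dualSelmerStructure (W.torsionGaloisModule n) (W.kummerSelmerStructure n)).selmerGroup) :
    galoisCohomology.map (weilDualInv W n e hμ hadd₁ hadd₂ hgal hnondeg) 1 y ∈ selmerGroup W (n : ℤ) := by
  have h : galoisCohomology.map (weilDualInv W n e hμ hadd₁ hadd₂ hgal hnondeg) 1 y ∈
      (W.kummerSelmerStructure (n : ℤ)).selmerGroup := by
    refine (SelmerStructure.mem_selmerGroup_iff _ _).mpr fun v ↦ ?_
    rw [localization_map_one]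
    exact map_weilDualInv_mem_kummerSelmerStructure_of_mem_dual W n e hμ hadd₁ hadd₂ hgal hnondeg inv v
      (hmax v) ((SelmerStructure.mem_selmerGroup_iff _ y).mp hy v)
  rw [selmerGroup_eq_selmerGroup_kummerSelmerStructure]
  exact h

end SelfDual

end Summit.BirchSwinnertonDyer.Rank1Residual.X11b.KummerDuality

end
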